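import Literature.NumberTheory.EllipticCurves.PAdicHeightsK
import Literature.NumberTheory.EllipticCurves.PAdicHeightsRegulatorProofs
import Literature.NumberTheory.EllipticCurves.QuadraticTwistRank
import Literature.NumberTheory.EllipticCurves.HeightsBaseChangeProofs
import Literature.NumberTheory.EllipticCurves.RegulatorProofs
import Literature.NumberTheory.EllipticCurves.RegulatorBasisProofs
import Literature.NumberTheory.EllipticCurves.MordellWeilTheoremProofs
import Literature.NumberTheory.EllipticCurves.HeightsProofs
import Literature.Barriers.BirchSwinnertonDyer.PAdicHeightNondegeneracyProofs
import HarnessLib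

/-!
# STEP C(1) of the kernel derivation of `hFact`: descent of the two height pairings from `E(K)` to
# `E(ℚ)` in rank one (cell `bsd-addord`, seat `bsd-addord-gz` gen 4)

HONEST FRAMING (cell `bsd-addord`; PARTITION (D-0054): EXCLUDED-DOMAIN additive rows §E, B6 = O7-ord r1 ×
every consumer of hFact — types-the-object-of; booked 0). THEOREMS ONLY, pure algebra of heights. For
`E = W/ℚ` with `rank E(ℚ) = 1`, a quadratic field `K` with `rank E^{(d_K)}(ℚ) = 0`, a `K`-height datum
`DhK` restricting to the `ℚ`-datum `Dh` with factor `c` (`RestrictsToWith`), and ANY two points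
`P₁, P₂ ∈ E(K)`: there is ONE rational `ρ` with
`⟨P₁,P₂⟩_{NT,K} = ρ · [K:ℚ] · Reg_∞(E/ℚ)` and `⟨P₁,P₂⟩_{DhK} = ρ · c · Reg_p(E, Dh)`
(`exists_rat_heightPairing_eq_and_pairing_eq`). Ingredients: `rank E(K) = rank E(ℚ) + rank E^{(d_K)}(ℚ)`
(tree, Silverman Ex. 10.16), Mordell–Weil (tree), so every `P ∈ E(K)` has a non-zero multiple in
`E(ℚ)` (`exists_zsmul_eq_pointToBaseChange`); a Mordell–Weil basis `{P₀}` of `E(ℚ)`; bilinearity and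
torsion-vanishing of both pairings; `⟨ιQ, ιQ′⟩_K = [K:ℚ]⟨Q,Q′⟩_ℚ` (tree `heightPairing_baseChange`). This is
the step "`P_i = n_i P + torsion`" of Disegni 2017 Thm. B ÷ (1.1.3) ⟹ the `ℚ`-identity (sheet §3).

Design (decidable equality of `ℚ`): the Néron–Tate / Mordell–Weil lemmas of the tree are stated for a
general field with the classical `DecidableEq`, the `ℚ`-height datum `PAdicHeightData` with `Rat`'s; the
proofs of §1 therefore elaborate `E(ℚ)` classically (`letI`) and transport across the subsingleton
`DecidableEq ℚ` with `convert`, as in `Wuthrich2014/RankOneEngineProofs`.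

References: [SilvermanAEC2009] Ex. 10.16, Thm. VIII.9.3; [MazurTateTeitelbaum1986Invent] §II.4–II.5;
[Disegni2017] Thm. B, (1.1.3).
-/

set_option autoImplicit false

noncomputable section

open scoped Classical NumberField

open WeierstrassCurve WeierstrassCurve.Affine.Point Literature.NumberTheory.EllipticCurves
  WeierstrassCurve.QuadraticDescent

namespace Summit.BirchSwinnertonDyer.Rank1Residual.Additive

/-! ### §1 The archimedean side and the capture of `E(K)` by `E(ℚ)` -/

section ClassicalSide


variable {W : WeierstrassCurve ℚ} [W.IsElliptic] (K : Type) [Field K] [NumberField K]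

/-- `s • x = 0` with `s ≠ 0` in `ℤ` makes `x` of finite order. [folklore] -/
theorem isOfFinAddOrder_of_zsmul_eq_zero {M : Type*} [AddCommGroup M] {x : M} {s : ℤ} (hs : s ≠ 0)
    (h : s • x = 0) : IsOfFinAddOrder x := by
  rw [isOfFinAddOrder_iff_nsmul_eq_zero]
  refine ⟨s.natAbs, Int.natAbs_pos.mpr hs, ?_⟩
  rcases Int.natAbs_eq s with hs' | hs'
  · rw [← natCast_zsmul, ← hs', h]
  · have : ((s.natAbs : ℤ)) = -s := by omega
    rw [← natCast_zsmul, this, neg_zsmul, h, _root_.neg_zero]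

/-- **Every point of `E(K)` has a non-zero multiple in `E(ℚ)`** when `K` is quadratic, `rank E(ℚ) = 1`
and `rank E^{(d_K)}(ℚ) = 0`: then `rank E(K) = 1` (Silverman Ex. 10.16 + Mordell–Weil), and two
elements of a finitely generated `ℤ`-module of rank one are linearly dependent.
[cite: SilvermanAEC2009, Exercise 10.16] -/
theorem exists_zsmul_eq_pointToBaseChange (h2 : Module.finrank ℚ K = 2) (hrk : W.mordellWeilRank = 1)
    (hrd : (W.quadraticTwist (NumberField.discr K : ℚ)).mordellWeilRank = 0)
    (P : (W.baseChange K).toAffine.Point) :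
    ∃ t : ℤ, t ≠ 0 ∧ ∃ Q : W.toAffine.Point, t • P = W.pointToBaseChange K Q := by
  letI : DecidableEq ℚ := fun a b ↦ Classical.propDecidable (a = b)
  haveI : (W.baseChange K).IsElliptic := inferInstanceAs (W.map (algebraMap ℚ K)).IsElliptic
  -- the hand-rolled inclusion of `PAdicHeightsK` is Mathlib's base-change hom `ι`
  have hincl : ∀ Q : W.toAffine.Point, W.pointToBaseChange K Q = incl K W Q := by
    rintro (_ | ⟨x, y, h⟩) <;> rfl
  have hinj : ∀ {Q : W.toAffine.Point}, IsOfFinAddOrder (incl K W Q) → IsOfFinAddOrder Q := by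
    intro Q h
    obtain ⟨n, hn, hnP⟩ := (isOfFinAddOrder_iff_nsmul_eq_zero).mp h
    rw [← map_nsmul] at hnP
    exact (isOfFinAddOrder_iff_nsmul_eq_zero).mpr
      ⟨n, hn, incl_injective W (hnP.trans (_root_.map_zero (incl K W)).symm)⟩
  haveI : Module.Finite ℤ (W.baseChange K).toAffine.Point := (W.baseChange K).module_finite_point_holds
  have hrK : (W.baseChange K).mordellWeilRank = 1 := by
    rw [mordellWeilRank_baseChange_of_finrank_eq_two_of_finite W K h2, hrk, hrd]
  -- a point of infinite order in `E(ℚ)`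
  obtain ⟨B, hB⟩ := W.exists_isMordellWeilBasis_holds
  let k : Fin W.mordellWeilRank := ⟨0, by omega⟩
  have hBk : ¬ IsOfFinAddOrder (B k) := hB.not_isOfFinAddOrder k
  set a : (W.baseChange K).toAffine.Point := incl K W (B k) with ha
  -- `a, P` are linearly dependent in the rank-one module `E(K)`
  have hdep : ¬ LinearIndependent ℤ ![a, P] := by
    intro hli
    have h := hli.fintype_card_le_finrank
    rw [Fintype.card_fin] at h
    change 2 ≤ (W.baseChange K).mordellWeilRank at h
    omega
  rw [LinearIndependent.pair_iff] at hdep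
  push Not at hdep
  obtain ⟨s, t, hst, hst0⟩ := hdep
  by_cases ht : t = 0
  · exfalso
    rw [ht, zero_smul, add_zero] at hst
    have hs : s ≠ 0 := fun hs ↦ hst0 hs ht
    exact hBk (by convert hinj (isOfFinAddOrder_of_zsmul_eq_zero hs hst))
  · refine ⟨t, ht, (-s) • B k, ?_⟩
    rw [hincl, map_zsmul, neg_zsmul, ← ha]
    exact eq_neg_of_add_eq_zero_right hst

omit [W.IsElliptic] in
/-- **Rank-one decomposition in `E(ℚ)`**: `Q = m • P₀ + T` on a Mordell–Weil basis `{P₀}`, `T` torsion.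
[cite: SilvermanAEC2009, VIII.6] -/
theorem exists_eq_zsmul_basis_add_torsion (hrk : W.mordellWeilRank = 1)
    {B : Fin W.mordellWeilRank → W.toAffine.Point} (hB : IsMordellWeilBasis B) (Q : W.toAffine.Point) :
    ∃ (m : ℤ) (T : W.toAffine.Point), IsOfFinAddOrder T ∧ Q = m • B ⟨0, by omega⟩ + T := by
  -- adapted from Literature/NumberTheory/EllipticCurves/Wuthrich2014/RankOneEngineProofs.lean
  letI : DecidableEq ℚ := fun a b ↦ Classical.propDecidable (a = b)
  let k : Fin W.mordellWeilRank := ⟨0, by omega⟩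
  have huniq : ∀ i : Fin W.mordellWeilRank, i = k := fun i ↦ Fin.ext (by have := i.2; omega)
  obtain ⟨m, hm⟩ : ∃ m : ℤ, m • (QuotientAddGroup.mk (B k) : mordellWeilModTorsion W) =
      QuotientAddGroup.mk Q := by
    have hmem : (QuotientAddGroup.mk Q : mordellWeilModTorsion W) ∈
        Submodule.span ℤ (Set.range (QuotientAddGroup.mk ∘ B :
          Fin W.mordellWeilRank → mordellWeilModTorsion W)) := by
      rw [hB.2]; exact Submodule.mem_top
    have hrange : Set.range (QuotientAddGroup.mk ∘ B :
        Fin W.mordellWeilRank → mordellWeilModTorsion W) = {QuotientAddGroup.mk (B k)} := by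
      ext x
      simp only [Set.mem_range, Set.mem_singleton_iff, Function.comp_apply]
      constructor
      · rintro ⟨i, rfl⟩; rw [huniq i]
      · rintro rfl; exact ⟨k, rfl⟩
    rw [hrange] at hmem
    exact Submodule.mem_span_singleton.mp hmem
  have h1 : (QuotientAddGroup.mk (m • B k) : mordellWeilModTorsion W) = QuotientAddGroup.mk Q := by
    rw [← hm, QuotientAddGroup.mk_zsmul]
  have hT : IsOfFinAddOrder (-(m • B k) + Q) := (AddCommGroup.mem_torsion _).mp (QuotientAddGroup.eq.mp h1)
  have hQ : Q = m • B k + (-(m • B k) + Q) := by abel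
  exact ⟨m, -(m • B k) + Q, by convert hT, by convert hQ⟩

/-- **The Néron–Tate pairing on a rank-one `E(ℚ)`**: `⟨Q₁, Q₂⟩ = m₁ m₂ · Reg_∞(E/ℚ)` for
`Q_i = m_i P₀ + T_i`. [cite: SilvermanAEC2009, Thm. VIII.9.3] -/
theorem heightPairing_eq_of_decomp (hrk : W.mordellWeilRank = 1)
    {B : Fin W.mordellWeilRank → W.toAffine.Point} (hB : IsMordellWeilBasis B) {Q₁ Q₂ T₁ T₂ : W.toAffine.Point}
    {m₁ m₂ : ℤ} (hT₁ : IsOfFinAddOrder T₁) (hT₂ : IsOfFinAddOrder T₂)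
    (hQ₁ : Q₁ = m₁ • B ⟨0, by omega⟩ + T₁) (hQ₂ : Q₂ = m₂ • B ⟨0, by omega⟩ + T₂) :
    heightPairing Q₁ Q₂ = (m₁ : ℝ) * m₂ * W.regulator := by
  letI : DecidableEq ℚ := fun a b ↦ Classical.propDecidable (a = b)
  let k : Fin W.mordellWeilRank := ⟨0, by omega⟩
  have hcard : Fintype.card (Fin W.mordellWeilRank) = 1 := by rw [Fintype.card_fin, hrk]
  have hReg : W.regulator = heightPairing (B k) (B k) := by
    rw [← hB.regulatorOf_eq_regulator, regulatorOf, Matrix.det_eq_elem_of_card_eq_one hcard k,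
      heightPairingMatrix_apply]
  have hT₁' : IsOfFinAddOrder T₁ := by convert hT₁
  have hT₂' : IsOfFinAddOrder T₂ := by convert hT₂
  have hQ₁' : Q₁ = m₁ • B k + T₁ := by convert hQ₁
  have hQ₂' : Q₂ = m₂ • B k + T₂ := by convert hQ₂
  rw [hQ₁', hQ₂', heightPairing_add_left_holds, heightPairing_add_right, heightPairing_add_right,
    heightPairing_eq_zero_of_isOfFinAddOrder_right _ hT₂',
    heightPairing_eq_zero_of_isOfFinAddOrder_left hT₁',
    heightPairing_eq_zero_of_isOfFinAddOrder_left hT₁', heightPairing_zsmul_left,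
    heightPairing_zsmul_right, hReg]
  ring

/-- **Néron–Tate heights of captured points**: if `t_i • P_i = ι(Q_i)` then
`t₁ t₂ ⟨P₁,P₂⟩_K = [K:ℚ] ⟨Q₁,Q₂⟩_ℚ` (tree `heightPairing_baseChange`).
[cite: SilvermanAEC2009, Prop. VIII.5.4(b), Thm. VIII.9.3] -/
theorem heightPairing_of_zsmul_eq_pointToBaseChange {P₁ P₂ : (W.baseChange K).toAffine.Point}
    {Q₁ Q₂ : W.toAffine.Point} {t₁ t₂ : ℤ} (h₁ : t₁ • P₁ = W.pointToBaseChange K Q₁)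
    (h₂ : t₂ • P₂ = W.pointToBaseChange K Q₂) :
    (t₁ : ℝ) * t₂ * P₁.heightPairing P₂ = (Module.finrank ℚ K : ℝ) * heightPairing Q₁ Q₂ := by
  letI : DecidableEq ℚ := fun a b ↦ Classical.propDecidable (a = b)
  haveI : (W.baseChange K).IsElliptic := inferInstanceAs (W.map (algebraMap ℚ K)).IsElliptic
  have hincl : ∀ Q : W.toAffine.Point, W.pointToBaseChange K Q = incl K W Q := by
    rintro (_ | ⟨x, y, h⟩) <;> rfl
  have e : heightPairing (t₁ • P₁) (t₂ • P₂) = (t₁ : ℝ) * ((t₂ : ℝ) * P₁.heightPairing P₂) := by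
    rw [heightPairing_zsmul_left, heightPairing_zsmul_right]
  rw [h₁, h₂, hincl, hincl] at e
  have h := heightPairing_baseChange (W := W) (K := ℚ) (L := K) Q₁ Q₂
  rw [← mul_assoc] at e
  rw [← e]
  exact h

end ClassicalSide

/-! ### §2 The two pairings with ONE rational (the `ℚ`-datum side uses `Rat`'s `DecidableEq`) -/

section Main

variable {W : WeierstrassCurve ℚ} [W.IsElliptic] (K : Type) [Field K] [NumberField K]
  {p : ℕ} [Fact p.Prime]

/-- **STEP C(1): one rational for both pairings.** `K` quadratic, `rank E(ℚ) = 1`,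
`rank E^{(d_K)}(ℚ) = 0`, `DhK` restricting to `Dh` with factor `c`; then for all `P₁, P₂ ∈ E(K)` there is
`ρ ∈ ℚ` with `⟨P₁,P₂⟩_{NT,K} = ρ·[K:ℚ]·Reg_∞(E/ℚ)` and `⟨P₁,P₂⟩_{DhK} = ρ·c·Reg_p(E,Dh)`.
[cite: Disegni2017, Theorem B and (1.1.3) (arXiv v3 PDF pp. 4–5, 9)]
[cite: MazurTateTeitelbaum1986Invent, §II.4–II.5] [cite: SilvermanAEC2009, Exercise 10.16, Thm. VIII.9.3] -/
theorem exists_rat_heightPairing_eq_and_pairing_eq (h2 : Module.finrank ℚ K = 2)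
    (hrk : W.mordellWeilRank = 1) (hrd : (W.quadraticTwist (NumberField.discr K : ℚ)).mordellWeilRank = 0)
    {Dh : PAdicHeightData W p} {DhK : PAdicHeightDataK W p K} {c : ℕ} (hres : DhK.RestrictsToWith Dh c)
    (P₁ P₂ : (W.baseChange K).toAffine.Point) :
    ∃ ρ : ℚ, (P₁.heightPairing P₂ : ℝ) = (ρ : ℝ) * (Module.finrank ℚ K : ℝ) * W.regulator ∧
      DhK.pairing P₁ P₂ = (ρ : ℚ_[p]) * (c : ℚ_[p]) * padicRegulator Dh := by
  obtain ⟨t₁, ht₁, Q₁, hQ₁⟩ := exists_zsmul_eq_pointToBaseChange K h2 hrk hrd P₁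
  obtain ⟨t₂, ht₂, Q₂, hQ₂⟩ := exists_zsmul_eq_pointToBaseChange K h2 hrk hrd P₂
  obtain ⟨B, hB⟩ := W.exists_isMordellWeilBasis_holds
  let k : Fin W.mordellWeilRank := ⟨0, by omega⟩
  have hcard : Fintype.card (Fin W.mordellWeilRank) = 1 := by rw [Fintype.card_fin, hrk]
  -- the decomposition `Q_i = m_i P₀ + T_i` and the real side, computed classically (§1), then
  -- transported across the subsingleton `DecidableEq ℚ`
  obtain ⟨m₁, m₂, T₁, T₂, hT₁, hT₂, hQ₁d, hQ₂d, hQQ⟩ : ∃ (m₁ m₂ : ℤ) (T₁ T₂ : W.toAffine.Point),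
      IsOfFinAddOrder T₁ ∧ IsOfFinAddOrder T₂ ∧ Q₁ = m₁ • B k + T₁ ∧ Q₂ = m₂ • B k + T₂ ∧
      heightPairing Q₁ Q₂ = (m₁ : ℝ) * m₂ * W.regulator := by
    letI : DecidableEq ℚ := fun a b ↦ Classical.propDecidable (a = b)
    obtain ⟨m₁, T₁, hT₁, hQ₁d⟩ := exists_eq_zsmul_basis_add_torsion hrk hB Q₁
    obtain ⟨m₂, T₂, hT₂, hQ₂d⟩ := exists_eq_zsmul_basis_add_torsion hrk hB Q₂
    have hQQ := heightPairing_eq_of_decomp hrk hB hT₁ hT₂ hQ₁d hQ₂d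
    exact ⟨m₁, m₂, T₁, T₂, by convert hT₁, by convert hT₂, by convert hQ₁d, by convert hQ₂d, hQQ⟩
  -- the `p`-adic side
  have hRegp : padicRegulator Dh = Dh.pairing (B k) (B k) := by
    rw [← padicRegulatorOf_eq_padicRegulator_holds Dh hB, padicRegulatorOf]
    convert Matrix.det_eq_elem_of_card_eq_one (A := Dh.pairingMatrix B) hcard k
    rfl
  have hQQp : Dh.pairing Q₁ Q₂ = (m₁ : ℚ_[p]) * m₂ * padicRegulator Dh := by
    rw [hQ₁d, hQ₂d]
    simp only [map_add, AddMonoidHom.add_apply, map_zsmul, AddMonoidHom.zsmul_apply,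
      Dh.map_torsion T₁ (B k) hT₁, Dh.map_torsion T₁ T₂ hT₁, Dh.map_torsion_right (B k) T₂ hT₂,
      hRegp, zsmul_eq_mul, smul_zero, add_zero]
    ring
  have hKp : (t₁ : ℚ_[p]) * t₂ * DhK.pairing P₁ P₂ = (c : ℚ_[p]) * Dh.pairing Q₁ Q₂ := by
    rw [← hres, ← hQ₁, ← hQ₂]
    simp only [map_zsmul, AddMonoidHom.zsmul_apply, zsmul_eq_mul]
    ring
  -- the real side
  have hK := heightPairing_of_zsmul_eq_pointToBaseChange K hQ₁ hQ₂
  have ht : ((t₁ : ℚ) * t₂) ≠ 0 := mul_ne_zero (Int.cast_ne_zero.mpr ht₁) (Int.cast_ne_zero.mpr ht₂)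
  refine ⟨(m₁ * m₂ : ℚ) / (t₁ * t₂), ?_, ?_⟩
  · have ht' : ((t₁ : ℝ) * t₂) ≠ 0 := by exact_mod_cast ht
    rw [hQQ] at hK
    push_cast
    field_simp
    linear_combination hK
  · have ht' : ((t₁ : ℚ_[p]) * t₂) ≠ 0 := by exact_mod_cast ht
    rw [hQQp] at hKp
    push_cast
    field_simp
    linear_combination hKp

end Main

end Summit.BirchSwinnertonDyer.Rank1Residual.Additive

end
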